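import Summits.HodgeConjecture.HodgeConjecture.Theorems.BiquadraticSecantLiftBaseChangeField
import Literature.AlgebraicGeometry.Motives.WeilDiscriminant
import HarnessLib

/-!
# BiquadraticSecantLift · X2 — traces and norms in the tower `ℚ ⊂ K = ℚ(√-d) ⊂ L = ℚ(√-d, √m) ⊃ F = ℚ(√m)`

Helper file for crux X2 `BiquadraticBaseChangeHyperbolic` (stmt-HodgeConjecture-22133) of
route-HodgeConjecture-BiquadraticSecantLift; continues `BiquadraticSecantLiftBaseChangeField`.

* §3 **Traces.** `L` is a `K`-algebra through `toL`, with `K`-basis `{1, √m}` (`√m ∉ K`, and `K·1 + K·√m` contains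
  `ℚ` and is stable under `· t`); `Tr_{L/K}(1) = 2`, `Tr_{L/K}(√m) = 0`, so by transitivity
  `Tr_{L/ℚ}(toL α + toL β·√m) = 2·Tr_{K/ℚ}(α)`. Consequences for Deligne's trace data (`tʲ Φ_{ab}`):
  `Tr_{L/ℚ}(tʲ·toL z) = 2·Tr_K(z), 2·Tr_K(t_K z), -2d(1+m)·Tr_K(z), -2d(1+3m)·Tr_K(t_K z)` for `j = 0, 1, 2, 3`.
* §4 **Norms / the discriminant transfer.** `(√m_F)² = m`, a `v ∈ F` with `d v² = a/b` (two cases: `adb` a square,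
  or `m = adb`), `ι(q_B) = t⁶ · toL(λ⁶ D)` for `q_B = λ⁶ q₀ (1+√m_F)⁶` when `toL(t_K⁶ D) = q₀`, and the class identity
  **`[q_B] = [(-1)³]` in `F^×/Nm_{L/F}(L^×)`** when `d v² = -q₀` (`-1/q_B = z z̄`, `z = (λ³(1+√m)³ v √-d)⁻¹`).

Pure algebra; nothing here is a case of the Hodge conjecture (HC is NOT proved; X2 is not proved by this file).

## References
[cite: Deligne1982HodgeCycles, §4 p. 30 (`disc`, `Nm_{E/F}`), Lemma 4.6] [cite: DummitFoote2004, §14.2 Exercises 17–18 (trace in towers)]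
-/

-- every declaration of this problem lives in `Summit.HodgeConjecture.HodgeConjecture.…` (summit = sub-problem)
set_option linter.dupNamespace false

noncomputable section

open Polynomial
open Literature.AlgebraicGeometry.Deligne1982

namespace Summit.HodgeConjecture.HodgeConjecture.BiquadraticSecantLift

/-! ## §3 Traces: `Tr_{L/ℚ}(tʲ · toL z)` through the tower `ℚ ⊂ K ⊂ L` and the `K`-basis `{1, √m}` -/

section Trace

variable (d m : ℕ)

/-- **Transitivity of the trace on the `K`-basis `{1, √m}` of `L`**: if `x = toL α + toL β · √m` (`α, β ∈ K`)
then `Tr_{L/ℚ}(x) = Tr_{K/ℚ}(Tr_{L/K} x) = Tr_{K/ℚ}(2α)` (`Tr_{L/K} √m = 0`). -/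
theorem trace_eq_two_mul_trace (hirrL : Irreducible (cmPolyQ (bqPoly d m)))
    (hirrK : Irreducible (cmPolyQ (X + C (d : ℤ)))) (hd : 0 < d) (hm : ¬ IsSquare m)
    {x : cmField (bqPoly d m)} {α β : cmField (X + C (d : ℤ))}
    (hx : x = toL d m hirrL hd hm α + toL d m hirrL hd hm β * sqrtM d m) :
    Algebra.trace ℚ (cmField (bqPoly d m)) x = 2 * Algebra.trace ℚ (cmField (X + C (d : ℤ))) α := by
  classical
  -- `L` as a `K`-algebra through `toL`
  letI alg : Algebra (cmField (X + C (d : ℤ))) (cmField (bqPoly d m)) := (toL d m hirrL hd hm).toAlgebra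
  haveI hst : IsScalarTower ℚ (cmField (X + C (d : ℤ))) (cmField (bqPoly d m)) :=
    IsScalarTower.of_algebraMap_eq fun q ↦ (toL_algebraMap d m hirrL hd hm q).symm
  set s : cmField (bqPoly d m) := sqrtM d m with hs
  set T : cmField (X + C (d : ℤ)) →+* cmField (bqPoly d m) := toL d m hirrL hd hm with hT
  have hsmul : ∀ (z : cmField (X + C (d : ℤ))) (y : cmField (bqPoly d m)), z • y = T z * y :=
    fun z y ↦ Algebra.smul_def z y
  have hsq : s ^ 2 = (m : cmField (bqPoly d m)) := sqrtM_sq d m hirrL hd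
  have htK : iK d m * (1 + s) = cmRoot (bqPoly d m) := iK_mul_one_add_sqrtM d m hirrL hd hm
  have hTt : T (cmRoot (X + C (d : ℤ))) = iK d m := toL_cmRoot d m hirrL hd hm
  -- ### `S = K·1 + K·√m` is all of `L`: it contains `ℚ`, is stable under `· t`, and `L = ℚ[t]`
  set S : Submodule (cmField (X + C (d : ℤ))) (cmField (bqPoly d m)) :=
    Submodule.span (cmField (X + C (d : ℤ))) {(1 : cmField (bqPoly d m)), s} with hSdef
  have hmemS : ∀ a b : cmField (X + C (d : ℤ)), T a + T b * s ∈ S := fun a b ↦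
    Submodule.mem_span_pair.2 ⟨a, b, by rw [hsmul, hsmul, mul_one]⟩
  have ht_mem : cmRoot (bqPoly d m) ∈ S := by
    have h : cmRoot (bqPoly d m) = T (cmRoot (X + C (d : ℤ))) + T (cmRoot (X + C (d : ℤ))) * s := by
      rw [hTt, ← htK]; ring
    rw [h]; exact hmemS _ _
  have hts_mem : cmRoot (bqPoly d m) * s ∈ S := by
    have h : cmRoot (bqPoly d m) * s =
        T ((m : cmField (X + C (d : ℤ))) * cmRoot (X + C (d : ℤ))) + T (cmRoot (X + C (d : ℤ))) * s := by
      rw [map_mul, map_natCast T, hTt, ← htK]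
      linear_combination (iK d m) * hsq
    rw [h]; exact hmemS _ _
  have hmulS : ∀ y ∈ S, cmRoot (bqPoly d m) * y ∈ S := by
    intro y hy
    obtain ⟨a, b, rfl⟩ := Submodule.mem_span_pair.1 hy
    rw [mul_add, mul_smul_comm, mul_smul_comm, mul_one]
    exact S.add_mem (S.smul_mem a ht_mem) (S.smul_mem b hts_mem)
  have hall : ∀ y : cmField (bqPoly d m), y ∈ S := by
    intro y
    induction y using AdjoinRoot.induction_on with
    | ih p =>
      induction p using Polynomial.induction_on with
      | C a =>
        have h : T (algebraMap ℚ (cmField (X + C (d : ℤ))) a) + T 0 * s = AdjoinRoot.mk (cmPolyQ (bqPoly d m)) (C a) := by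
          rw [map_zero, zero_mul, add_zero, hT, toL_algebraMap, AdjoinRoot.mk_C, AdjoinRoot.algebraMap_eq]
        rw [← h]; exact hmemS _ _
      | add p q hp hq => rw [map_add]; exact S.add_mem hp hq
      | monomial n a h =>
        rw [pow_succ, ← mul_assoc, map_mul, AdjoinRoot.mk_X, mul_comm]
        exact hmulS _ h
  -- ### `{1, √m}` is `K`-free (`√m ∉ K`), hence a `K`-basis of `L`
  have hli : LinearIndependent (cmField (X + C (d : ℤ))) ![(1 : cmField (bqPoly d m)), s] := by
    refine LinearIndependent.pair_iff.2 fun a b hab ↦ ?_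
    rw [hsmul, hsmul, mul_one] at hab
    haveI : Fact (Irreducible (cmPolyQ (X + C (d : ℤ)))) := ⟨hirrK⟩
    haveI : Fact (Irreducible (cmPolyQ (bqPoly d m))) := ⟨hirrL⟩
    by_cases hb : b = 0
    · refine ⟨?_, hb⟩
      rw [hb, map_zero, zero_mul, add_zero] at hab
      exact (map_eq_zero_iff T T.injective).1 hab
    · exfalso
      have hTb : T b ≠ 0 := (map_ne_zero_iff T T.injective).2 hb
      refine sqrtM_not_mem_range_toL d m hirrL hd hm ⟨-a / b, ?_⟩
      rw [← hT, map_div₀, map_neg, div_eq_iff hTb]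
      linear_combination -hab
  have hsp : ⊤ ≤ Submodule.span (cmField (X + C (d : ℤ))) (Set.range ![(1 : cmField (bqPoly d m)), s]) := by
    rintro y -
    rw [Matrix.range_cons_cons_empty]
    exact hall y
  let bL : Module.Basis (Fin 2) (cmField (X + C (d : ℤ))) (cmField (bqPoly d m)) := Module.Basis.mk hli hsp
  have hbL0 : bL 0 = 1 := by
    change (Module.Basis.mk hli hsp) 0 = 1
    rw [Module.Basis.coe_mk]; rfl
  have hbL1 : bL 1 = s := by
    change (Module.Basis.mk hli hsp) 1 = s
    rw [Module.Basis.coe_mk]; rfl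
  -- ### `Tr_{L/K}(1) = 2`, `Tr_{L/K}(√m) = 0`, so `Tr_{L/K}(x) = 2α`
  have htr1 : Algebra.trace (cmField (X + C (d : ℤ))) (cmField (bqPoly d m)) 1 = 2 := by
    have h := Algebra.trace_algebraMap_of_basis bL (1 : cmField (X + C (d : ℤ)))
    rw [map_one, Fintype.card_fin] at h
    rw [h, nsmul_eq_mul, Nat.cast_ofNat, mul_one]
  have htrs : Algebra.trace (cmField (X + C (d : ℤ))) (cmField (bqPoly d m)) s = 0 := by
    rw [Algebra.trace_eq_matrix_trace bL, Matrix.trace_fin_two, Algebra.leftMulMatrix_eq_repr_mul,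
      Algebra.leftMulMatrix_eq_repr_mul, hbL0, hbL1, mul_one]
    have h1 : bL.repr s = Finsupp.single 1 1 := by rw [← hbL1, Module.Basis.repr_self]
    have h2 : bL.repr (s * s) = Finsupp.single 0 (m : cmField (X + C (d : ℤ))) := by
      have h : s * s = (m : cmField (X + C (d : ℤ))) • bL 0 := by rw [hbL0, hsmul, map_natCast T, mul_one, ← sq, hsq]
      rw [h, map_smul, Module.Basis.repr_self, Finsupp.smul_single_one]
    rw [h1, h2, Finsupp.single_apply, Finsupp.single_apply, if_neg (by decide), if_neg (by decide), add_zero]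
  have htrx : Algebra.trace (cmField (X + C (d : ℤ))) (cmField (bqPoly d m)) x = 2 * α := by
    have hx' : x = α • (1 : cmField (bqPoly d m)) + β • s := by rw [hx, hsmul, hsmul, mul_one]
    rw [hx', map_add, map_smul, map_smul, htr1, htrs, smul_zero, add_zero, smul_eq_mul, mul_comm]
  -- ### transitivity `Tr_{L/ℚ} = Tr_{K/ℚ} ∘ Tr_{L/K}`
  have hmonK : (cmPolyQ (X + C (d : ℤ))).Monic := by
    rw [cmPolyQ_quadratic]; exact monic_X_pow_add_C _ two_ne_zero
  have key := Algebra.trace_trace_of_basis (AdjoinRoot.powerBasis' hmonK).basis bL x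
  rw [htrx] at key
  rw [← key]
  have h2 : (2 : cmField (X + C (d : ℤ))) * α = (2 : ℚ) • α := by rw [Algebra.smul_def, map_ofNat]
  rw [h2, map_smul, smul_eq_mul]

/-- **`Tr_{L/ℚ}(toL z) = 2 · Tr_{K/ℚ}(z)`.** -/
theorem trace_toL (hirrL : Irreducible (cmPolyQ (bqPoly d m))) (hirrK : Irreducible (cmPolyQ (X + C (d : ℤ))))
    (hd : 0 < d) (hm : ¬ IsSquare m) (z : cmField (X + C (d : ℤ))) :
    Algebra.trace ℚ (cmField (bqPoly d m)) (toL d m hirrL hd hm z) = 2 * Algebra.trace ℚ (cmField (X + C (d : ℤ))) z :=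
  trace_eq_two_mul_trace d m hirrL hirrK hd hm (β := 0) (by rw [map_zero, zero_mul, add_zero])

/-- **`Tr_{L/ℚ}(t · toL z) = 2 · Tr_{K/ℚ}(t_K z)`** (`t = √-d (1 + √m)`). -/
theorem trace_cmRoot_mul_toL (hirrL : Irreducible (cmPolyQ (bqPoly d m)))
    (hirrK : Irreducible (cmPolyQ (X + C (d : ℤ)))) (hd : 0 < d) (hm : ¬ IsSquare m) (z : cmField (X + C (d : ℤ))) :
    Algebra.trace ℚ (cmField (bqPoly d m)) (cmRoot (bqPoly d m) * toL d m hirrL hd hm z) =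
      2 * Algebra.trace ℚ (cmField (X + C (d : ℤ))) (cmRoot (X + C (d : ℤ)) * z) :=
  trace_eq_two_mul_trace d m hirrL hirrK hd hm (β := cmRoot (X + C (d : ℤ)) * z) (by
    rw [map_mul, toL_cmRoot, ← iK_mul_one_add_sqrtM d m hirrL hd hm]; ring)

/-- **`Tr_{L/ℚ}(t² · toL z) = -2d(1+m) · Tr_{K/ℚ}(z)`** (`t² = -d(1+m) - 2d√m`). -/
theorem trace_cmRoot_sq_mul_toL (hirrL : Irreducible (cmPolyQ (bqPoly d m)))
    (hirrK : Irreducible (cmPolyQ (X + C (d : ℤ)))) (hd : 0 < d) (hm : ¬ IsSquare m) (z : cmField (X + C (d : ℤ))) :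
    Algebra.trace ℚ (cmField (bqPoly d m)) (cmRoot (bqPoly d m) ^ 2 * toL d m hirrL hd hm z) =
      -(2 * (d : ℚ) * (1 + (m : ℚ))) * Algebra.trace ℚ (cmField (X + C (d : ℤ))) z := by
  have h := trace_eq_two_mul_trace d m hirrL hirrK hd hm (x := cmRoot (bqPoly d m) ^ 2 * toL d m hirrL hd hm z)
    (α := -((d : cmField (X + C (d : ℤ))) * (1 + (m : cmField (X + C (d : ℤ))))) * z)
    (β := -(2 * (d : cmField (X + C (d : ℤ)))) * z) (by
      rw [map_mul, map_mul, map_neg, map_neg, map_mul, map_mul, map_add, map_one, map_natCast (toL d m hirrL hd hm),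
        map_natCast (toL d m hirrL hd hm), map_ofNat (toL d m hirrL hd hm), cmRoot_sq_eq' d m hirrL hd]
      ring)
  rw [h]
  have h2 : -((d : cmField (X + C (d : ℤ))) * (1 + (m : cmField (X + C (d : ℤ))))) * z =
      (-((d : ℚ) * (1 + (m : ℚ)))) • z := by
    rw [Algebra.smul_def, map_neg, map_mul, map_add, map_one, map_natCast (algebraMap ℚ (cmField (X + C (d : ℤ)))),
      map_natCast (algebraMap ℚ (cmField (X + C (d : ℤ))))]
  rw [h2, map_smul, smul_eq_mul]
  ring

/-- **`Tr_{L/ℚ}(t³ · toL z) = -2d(1+3m) · Tr_{K/ℚ}(t_K z)`** (`t³ = -d√-d((1+3m) + (3+m)√m)`). -/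
theorem trace_cmRoot_pow_three_mul_toL (hirrL : Irreducible (cmPolyQ (bqPoly d m)))
    (hirrK : Irreducible (cmPolyQ (X + C (d : ℤ)))) (hd : 0 < d) (hm : ¬ IsSquare m) (z : cmField (X + C (d : ℤ))) :
    Algebra.trace ℚ (cmField (bqPoly d m)) (cmRoot (bqPoly d m) ^ 3 * toL d m hirrL hd hm z) =
      -(2 * (d : ℚ) * (1 + 3 * (m : ℚ))) * Algebra.trace ℚ (cmField (X + C (d : ℤ))) (cmRoot (X + C (d : ℤ)) * z) := by
  have h := trace_eq_two_mul_trace d m hirrL hirrK hd hm (x := cmRoot (bqPoly d m) ^ 3 * toL d m hirrL hd hm z)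
    (α := -((d : cmField (X + C (d : ℤ))) * (1 + 3 * (m : cmField (X + C (d : ℤ))))) * (cmRoot (X + C (d : ℤ)) * z))
    (β := -((d : cmField (X + C (d : ℤ))) * (3 + (m : cmField (X + C (d : ℤ))))) * (cmRoot (X + C (d : ℤ)) * z)) (by
      rw [map_mul, map_mul, map_mul, map_mul, map_neg, map_neg, map_mul, map_mul, map_add, map_add, map_one, map_mul,
        map_natCast (toL d m hirrL hd hm), map_natCast (toL d m hirrL hd hm), map_ofNat (toL d m hirrL hd hm),
        toL_cmRoot, cmRoot_pow_three_eq d m hirrL hd hm]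
      ring)
  rw [h]
  have h2 : -((d : cmField (X + C (d : ℤ))) * (1 + 3 * (m : cmField (X + C (d : ℤ))))) * (cmRoot (X + C (d : ℤ)) * z) =
      (-((d : ℚ) * (1 + 3 * (m : ℚ)))) • (cmRoot (X + C (d : ℤ)) * z) := by
    rw [Algebra.smul_def, map_neg, map_mul, map_add, map_one, map_mul, map_ofNat (algebraMap ℚ (cmField (X + C (d : ℤ)))),
      map_natCast (algebraMap ℚ (cmField (X + C (d : ℤ)))), map_natCast (algebraMap ℚ (cmField (X + C (d : ℤ))))]
  rw [h2, map_smul, smul_eq_mul]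
  ring

end Trace

/-! ## §4 The real quadratic subfield `F = ℚ(√m)` of `L` and the norm `Nm_{L/F}`: the discriminant transfer -/

section Norm

variable (d m : ℕ)

/-- `toL` on rational constants, `AdjoinRoot.of` form. -/
theorem toL_of (hirr : Irreducible (cmPolyQ (bqPoly d m))) (hd : 0 < d) (hm : ¬ IsSquare m) (q : ℚ) :
    toL d m hirr hd hm (AdjoinRoot.of (cmPolyQ (X + C (d : ℤ))) q) = AdjoinRoot.of (cmPolyQ (bqPoly d m)) q :=
  AdjoinRoot.lift_of _

/-- `realToCM` is injective when `F` is a field and `L ≠ 0`. -/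
theorem realToCM_injective (hirrL : Irreducible (cmPolyQ (bqPoly d m))) (hirrF : Irreducible (realPolyQ (bqPoly d m))) :
    Function.Injective (realToCM (bqPoly d m)) := by
  haveI : Fact (Irreducible (cmPolyQ (bqPoly d m))) := ⟨hirrL⟩
  haveI : Fact (Irreducible (realPolyQ (bqPoly d m))) := ⟨hirrF⟩
  exact (realToCM (bqPoly d m)).injective

/-- **`(√m_F)² = m` in `F`.** -/
theorem sqrtMReal_sq (hirrL : Irreducible (cmPolyQ (bqPoly d m))) (hirrF : Irreducible (realPolyQ (bqPoly d m)))
    (hd : 0 < d) : sqrtMReal d m ^ 2 = (m : realField (bqPoly d m)) := by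
  apply realToCM_injective d m hirrL hirrF
  rw [map_pow, realToCM_sqrtMReal, sqrtM_sq d m hirrL hd, map_natCast]

/-- `1 + √m_F ≠ 0` in `F`. -/
theorem one_add_sqrtMReal_ne_zero (hirrL : Irreducible (cmPolyQ (bqPoly d m))) (hd : 0 < d) (hm : ¬ IsSquare m) :
    1 + sqrtMReal d m ≠ 0 := by
  intro h
  have h' := congrArg (realToCM (bqPoly d m)) h
  rw [map_add, map_one, realToCM_sqrtMReal, map_zero] at h'
  exact (one_sub_sqrtM_ne_zero d m hirrL hd hm).2.1 h'

/-- **A `v ∈ F` with `d·v² = a/b`, case `a·d·b` a square**: `v = c/(bd)` with `c² = adb`. -/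
theorem exists_mul_sq_eq_of_isSquare (hirrF : Irreducible (realPolyQ (bqPoly d m))) (hd : 0 < d) {a b : ℕ} (hb : 0 < b)
    (hsq : IsSquare (a * d * b)) :
    ∃ v : realField (bqPoly d m), (d : realField (bqPoly d m)) * v ^ 2 = AdjoinRoot.of (realPolyQ (bqPoly d m)) ((a : ℚ) / b) := by
  haveI : Fact (Irreducible (realPolyQ (bqPoly d m))) := ⟨hirrF⟩
  obtain ⟨c, hc⟩ := hsq
  refine ⟨AdjoinRoot.of (realPolyQ (bqPoly d m)) ((c : ℚ) / ((b : ℚ) * d)), ?_⟩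
  rw [← map_natCast (AdjoinRoot.of (realPolyQ (bqPoly d m))) d, ← map_pow, ← map_mul]
  congr 1
  have hb' : (b : ℚ) ≠ 0 := Nat.cast_ne_zero.2 hb.ne'
  have hd' : (d : ℚ) ≠ 0 := Nat.cast_ne_zero.2 hd.ne'
  have hc' : ((a : ℚ) * d * b) = (c : ℚ) * c := by exact_mod_cast hc
  rw [div_pow, sq, ← hc']
  field_simp

/-- **A `v ∈ F` with `d·v² = a/b`, case `m = a·d·b`**: `v = √m/(bd)`. -/
theorem exists_mul_sq_eq_of_eq (hirrL : Irreducible (cmPolyQ (bqPoly d m))) (hirrF : Irreducible (realPolyQ (bqPoly d m)))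
    (hd : 0 < d) {a b : ℕ} (hb : 0 < b) (hmab : m = a * d * b) :
    ∃ v : realField (bqPoly d m), (d : realField (bqPoly d m)) * v ^ 2 = AdjoinRoot.of (realPolyQ (bqPoly d m)) ((a : ℚ) / b) := by
  haveI : Fact (Irreducible (realPolyQ (bqPoly d m))) := ⟨hirrF⟩
  have hsq := sqrtMReal_sq d m hirrL hirrF hd
  refine ⟨sqrtMReal d m * AdjoinRoot.of (realPolyQ (bqPoly d m)) (1 / ((b : ℚ) * d)), ?_⟩
  rw [mul_pow, hsq, ← map_natCast (AdjoinRoot.of (realPolyQ (bqPoly d m))) d,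
    ← map_natCast (AdjoinRoot.of (realPolyQ (bqPoly d m))) m, ← map_pow, ← map_mul, ← map_mul]
  congr 1
  have hb' : (b : ℚ) ≠ 0 := Nat.cast_ne_zero.2 hb.ne'
  have hd' : (d : ℚ) ≠ 0 := Nat.cast_ne_zero.2 hd.ne'
  rw [hmab]
  push_cast
  field_simp

/-- The transferred discriminant representative `q_B = λ⁶ q₀ (1 + √m_F)⁶ ∈ F`. -/
theorem qB_ne_zero (hirrL : Irreducible (cmPolyQ (bqPoly d m))) (hirrF : Irreducible (realPolyQ (bqPoly d m)))
    (hd : 0 < d) (hm : ¬ IsSquare m) {q₀ c : ℚ} (hq₀ : q₀ ≠ 0) (hc : c ≠ 0) :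
    AdjoinRoot.of (realPolyQ (bqPoly d m)) (c ^ 6 * q₀) * (1 + sqrtMReal d m) ^ 6 ≠ 0 := by
  haveI : Fact (Irreducible (realPolyQ (bqPoly d m))) := ⟨hirrF⟩
  haveI : Fact (Irreducible (cmPolyQ (bqPoly d m))) := ⟨hirrL⟩
  refine mul_ne_zero ?_ (pow_ne_zero _ (one_add_sqrtMReal_ne_zero d m hirrL hd hm))
  rw [Ne, map_eq_zero_iff _ (AdjoinRoot.of (realPolyQ (bqPoly d m))).injective]
  exact mul_ne_zero (pow_ne_zero _ hc) hq₀

/-- **`ι(q_B) = t⁶ · toL(λ⁶ D)`** when `toL(t_K⁶ D) = q₀` (`D = det Φ_A`, `t_K⁶ D = q_A = q₀ ∈ ℚ`):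
`t⁶ = -d³(1+√m)⁶`, `toL t_K⁶ = (√-d)⁶ = -d³`. -/
theorem realToCM_qB (hirrL : Irreducible (cmPolyQ (bqPoly d m))) (hd : 0 < d) (hm : ¬ IsSquare m) {q₀ c : ℚ}
    {D : cmField (X + C (d : ℤ))}
    (hD : toL d m hirrL hd hm (cmRoot (X + C (d : ℤ)) ^ 6 * D) = AdjoinRoot.of (cmPolyQ (bqPoly d m)) q₀) :
    realToCM (bqPoly d m) (AdjoinRoot.of (realPolyQ (bqPoly d m)) (c ^ 6 * q₀) * (1 + sqrtMReal d m) ^ 6) =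
      cmRoot (bqPoly d m) ^ 6 * toL d m hirrL hd hm ((AdjoinRoot.of (cmPolyQ (X + C (d : ℤ))) c) ^ 6 * D) := by
  haveI : Fact (Irreducible (cmPolyQ (bqPoly d m))) := ⟨hirrL⟩
  haveI := charZero_cmField_bqPoly d m hirrL
  have ht2 := cmRoot_sq_eq d m hirrL hd
  have hi2 := iK_sq d m hirrL hd hm
  have hdL : (d : cmField (bqPoly d m)) ≠ 0 := Nat.cast_ne_zero.2 hd.ne'
  rw [map_mul, map_pow, toL_cmRoot] at hD
  -- `toL D = q₀ / (√-d)⁶ = -q₀/d³`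
  have hi6 : iK d m ^ 6 = -(d : cmField (bqPoly d m)) ^ 3 := by
    rw [show (6 : ℕ) = 2 * 3 from rfl, pow_mul, hi2, neg_pow, pow_succ, pow_succ, pow_one]; ring
  have ht6 : cmRoot (bqPoly d m) ^ 6 = -((d : cmField (bqPoly d m)) ^ 3 * (1 + sqrtM d m) ^ 6) := by
    rw [show (6 : ℕ) = 2 * 3 from rfl, pow_mul, ht2, pow_mul]; ring
  have hD' : toL d m hirrL hd hm D = -(AdjoinRoot.of (cmPolyQ (bqPoly d m)) q₀) / (d : cmField (bqPoly d m)) ^ 3 := by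
    rw [hi6] at hD
    rw [eq_div_iff (pow_ne_zero _ hdL)]
    linear_combination -hD
  rw [map_mul (toL d m hirrL hd hm), map_pow (toL d m hirrL hd hm), toL_of, hD', ht6, map_mul (realToCM (bqPoly d m)),
    map_pow (realToCM (bqPoly d m)), map_add, map_one, realToCM_sqrtMReal, realToCM_of, AdjoinRoot.algebraMap_eq, map_mul,
    map_pow]
  field_simp

/-- **The discriminant class transfers to the split class: `[q_B] = [(-1)³]` in `F^×/Nm_{L/F}(L^×)`** when
`d·v² = -q₀` for some `v ∈ F` (`-q₀ > 0`): `-1/q_B = z z̄` for `z = (λ³ (1+√m)³ · v · √-d)⁻¹`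
(`√-d · \\overline{√-d} = d`). -/
theorem mk_qB_eq_mk_neg_one [Fact (Irreducible (realPolyQ (bqPoly d m)))] [Fact (Irreducible (cmPolyQ (bqPoly d m)))]
    (hd : 0 < d) (hm : ¬ IsSquare m) {q₀ c : ℚ} {v : realField (bqPoly d m)}
    (hv : (d : realField (bqPoly d m)) * v ^ 2 = AdjoinRoot.of (realPolyQ (bqPoly d m)) (-q₀))
    (hqB : AdjoinRoot.of (realPolyQ (bqPoly d m)) (c ^ 6 * q₀) * (1 + sqrtMReal d m) ^ 6 ≠ 0) :
    (QuotientGroup.mk (Units.mk0 _ hqB) : cmNormResidueGroup (bqPoly d m)) =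
      QuotientGroup.mk ((-1 : (realField (bqPoly d m))ˣ) ^ 3) := by
  have hirrL : Irreducible (cmPolyQ (bqPoly d m)) := Fact.out
  haveI := charZero_cmField_bqPoly d m hirrL
  set w : realField (bqPoly d m) := AdjoinRoot.of (realPolyQ (bqPoly d m)) (c ^ 3) * (1 + sqrtMReal d m) ^ 3 * v with hw
  set z : cmField (bqPoly d m) := (realToCM (bqPoly d m) w * iK d m)⁻¹ with hz
  have hinj := (realToCM (bqPoly d m)).injective
  -- `ι(q_B) = -(ι w)² d`
  have hqw : realToCM (bqPoly d m) (AdjoinRoot.of (realPolyQ (bqPoly d m)) (c ^ 6 * q₀) * (1 + sqrtMReal d m) ^ 6) =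
      -((realToCM (bqPoly d m) w) ^ 2 * (d : cmField (bqPoly d m))) := by
    have hv' := congrArg (realToCM (bqPoly d m)) hv
    simp only [map_mul, map_natCast, map_pow, realToCM_of, map_neg, AdjoinRoot.algebraMap_eq] at hv'
    simp only [hw, map_mul, map_pow, map_add, map_one, realToCM_of, AdjoinRoot.algebraMap_eq]
    linear_combination (AdjoinRoot.of (cmPolyQ (bqPoly d m)) c) ^ 6 *
      (1 + realToCM (bqPoly d m) (sqrtMReal d m)) ^ 6 * hv'
  have hw0 : realToCM (bqPoly d m) w ≠ 0 := by
    intro h0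
    rw [h0, zero_pow two_ne_zero, zero_mul, neg_zero, map_eq_zero_iff _ hinj] at hqw
    exact hqB hqw
  have hi0 := iK_ne_zero d m hirrL hd hm
  have hz0 : z ≠ 0 := inv_ne_zero (mul_ne_zero hw0 hi0)
  rw [QuotientGroup.eq]
  refine Literature.AlgebraicGeometry.Motives.mem_normUnitsSubgroup_iff.2 ⟨Units.mk0 z hz0, hinj ?_⟩
  rw [← algebraMap_realField_eq, algebraMap_norm_eq_mul_cmConj, algebraMap_realField_eq, Units.val_mul,
    Units.val_inv_eq_inv_val, Units.val_mk0, Units.val_mk0, Units.val_pow_eq_pow_val, Units.val_neg, Units.val_one,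
    map_mul (realToCM (bqPoly d m)), map_inv₀ (realToCM (bqPoly d m)), hqw, map_pow (realToCM (bqPoly d m)),
    map_neg (realToCM (bqPoly d m)), map_one, hz]
  simp only [map_inv₀, map_mul, cmConj_realToCM, cmConj_iK]
  have hi2 := iK_sq d m hirrL hd hm
  have hdL : (d : cmField (bqPoly d m)) ≠ 0 := Nat.cast_ne_zero.2 hd.ne'
  field_simp
  linear_combination -hi2

end Norm

end Summit.HodgeConjecture.HodgeConjecture.BiquadraticSecantLift
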